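import Mathlib
import Summits.NavierStokesRegularity.NavierStokesRegularity.Theses.RootDecompPointVertex
import HarnessLib

/-!
# RootDecompPointVertex — glue `LeanTangentPeriodicity_of_pieces` (stmt-NavierStokesRegularity-31916) PROVED

Route N18 `route-NavierStokesRegularity-RootDecompPointVertex`, the GLUE of the SCALE ECHO split of DSS♭
`LeanTangentPeriodicity` (lens-4 g10 `periodicity_of_pieces`, HOME/decomp-ns-lens-4/ScaleEcho.lean §5; writer
evidence `GlueProofN18D.lean`, not mounted in this seat's jail — re-proved here on the tree decls):
`LeanTangentRecurrence → LeanTangentEcho → LeanEchoIsPeriodic → LeanTangentPeriodicity`. Leanness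
`ε := min ε₁ (min ε₂ ε₃)` (the near-minimality hypothesis is monotone in `ε`); REC turns the tangent flow of the
hypothesis into a scale-recurrent one, ECHO into a scale echo, ECHO′ into a rotated-DSS one. Pure logic;
Navier–Stokes regularity is NOT proved by anything here (rung 0).
-/

-- the summit and its single sub-problem share the name (CONVENTIONS §1), as in every Theorems file
set_option linter.dupNamespace false

open MeasureTheory
open scoped ENNReal

namespace Summit.NavierStokesRegularity.NavierStokesRegularity.Theorems.PointVertex

open Summit.NavierStokesRegularity.NavierStokesRegularity.Theses.RootDecompPointVertex

/-- **Glue of the scale-echo split** (stmt-NavierStokesRegularity-31916): REC → ECHO → ECHO′ → DSS♭ with leanness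
`min ε₁ (min ε₂ ε₃)` (lens-4 g10 `periodicity_of_pieces` on the tree decls). [folklore] -/
theorem leanTangentPeriodicity_of_pieces_proof : LeanTangentPeriodicity_of_pieces := by
  unfold LeanTangentPeriodicity_of_pieces LeanTangentPeriodicity LeanTangentRecurrence LeanTangentEcho
    LeanEchoIsPeriodic
  rintro ⟨ε₁, hε₁, h₁⟩ ⟨ε₂, hε₂, h₂⟩ ⟨ε₃, hε₃, h₃⟩
  refine ⟨min ε₁ (min ε₂ ε₃), lt_min hε₁ (lt_min hε₂ hε₃), ?_⟩
  intro ν T hν hT u p hmax hLH hdec hmarg hlean hTI hU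
  have hm₁ : min ε₁ (min ε₂ ε₃) ≤ ε₁ := min_le_left _ _
  have hm₂ : min ε₁ (min ε₂ ε₃) ≤ ε₂ := (min_le_right _ _).trans (min_le_left _ _)
  have hm₃ : min ε₁ (min ε₂ ε₃) ≤ ε₃ := (min_le_right _ _).trans (min_le_right _ _)
  obtain ⟨U₁, hU₁⟩ := h₁ ν T hν hT u p hmax hLH hdec hmarg
    (fun v hv hK => (hlean v hv hK).trans (by gcongr)) hTI hU
  obtain ⟨U₂, hU₂⟩ := h₂ ν T hν hT u p hmax hLH hdec hmarg
    (fun v hv hK => (hlean v hv hK).trans (by gcongr)) hTI ⟨U₁, hU₁⟩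
  exact h₃ ν T hν hT u p hmax hLH hdec hmarg
    (fun v hv hK => (hlean v hv hK).trans (by gcongr)) hTI ⟨U₂, hU₂⟩

end Summit.NavierStokesRegularity.NavierStokesRegularity.Theorems.PointVertex
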